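import Mathlib
import HarnessLib
import Literature.Analysis.Calculus.PlaneIsoparametricLines

/-!
# Route `PoloidalWindowDoor`, crux K2 `PoloidalWindowRigidity` (stmt-NavierStokesRegularity-19708), line lrc-jet v5, brick F5 (part 1):
# the SLICE GLUE `ℝ² ↔ ℝ³` and the planar Levi-Civita–Segre dichotomy READ ON A HORIZONTAL PLANE OF `ℝ³`

Cell ns-regularity-ideate, seat ns-poloidal-K2-p3 gen 5 (lineage brick OFFERED by the K2 lead ns-poloidal-K2-p1 g6, BRIEF-v5-bricks.md F5; landed
`--supports stmt-NavierStokesRegularity-19708` as a helper).  The horizontal plane at height `z` is parametrised by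
`ι_z x = (x₀, x₁, z)` (`x ∈ ℝ²`); for `f : ℝ³ → ℝ` the slice `u = f ∘ ι_z` has `∂ᵢu(x) = ∂ᵢf(ι_z x)` and `∂ⱼ∂ᵢu(x) = ∂ⱼ∂ᵢf(ι_z x)` (`i, j ∈ {0,1}`,
horizontal derivatives of `f`), and `u` is `C^n` on `ι_z⁻¹ U` when `f` is `C^n` on `U`.  Consequently the hypotheses «`|∇_h f|² = a(f)`, `Δ_h f = b(f)` at the
points of height `z` of an open `U ⊆ ℝ³`» are the isoparametric hypotheses of `Literature.Analysis.Calculus.PlaneIsoparametric.circles_or_lines_of_isoparametric` for `u`,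
and its conclusion reads, in `ℝ³` terms: on a planar open piece either `∇_h f(ι_z x) = λ₂(f)·(x − c)` (concentric circles about ONE centre `c`) or
`∇_h f(ι_z x) ∥ ∇_h f(y₀)` (parallel lines).

* `hplane_apply`, `hplane_eq`, `continuous_hplane`, `hasFDerivAt_hplane`, `hplaneLin_single` — the embedding and its derivative;
* `fderiv_comp_hplane`, `differentiableAt_comp_hplane`, `contDiffOn_comp_hplane`, `fderiv2_comp_hplane` — the glue;
* `circles_or_lines_of_isoparametric_slice` — the dichotomy on a horizontal plane of `ℝ³`.

WHAT THIS IS NOT: not a claim about Navier–Stokes regularity — calculus plumbing for brick F5 of `stub_untwisted` (bears_on LADDER-NS N0 via crux 19708).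
-/

noncomputable section

-- the summit and its single sub-problem share the name (CONVENTIONS §1), as in every Theorems file
set_option linter.dupNamespace false

namespace Summit.NavierStokesRegularity.NavierStokesRegularity.Theorems.PoloidalWindowDoorPoloidalWindowRigidityUntwistedSliceGlue

open Set Function Filter Topology Metric
open Literature.Analysis.Calculus Literature.Analysis.Calculus.PlaneIsoparametric

/-! ### The embedding `ι_z : ℝ² → ℝ³`, `x ↦ (x₀, x₁, z)` -/

/-- Coordinates of `ι_z x`. -/
theorem hplane_apply (z : ℝ) (x : EuclideanSpace ℝ (Fin 2)) :
    (WithLp.toLp 2 ![x 0, x 1, z] : EuclideanSpace ℝ (Fin 3)) 0 = x 0 ∧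
      (WithLp.toLp 2 ![x 0, x 1, z] : EuclideanSpace ℝ (Fin 3)) 1 = x 1 ∧
      (WithLp.toLp 2 ![x 0, x 1, z] : EuclideanSpace ℝ (Fin 3)) 2 = z :=
  ⟨rfl, rfl, rfl⟩

/-- The embedding is affine: `ι_z x = Λ x + z e₂` with the linear part `Λ x = x₀ e₀ + x₁ e₁`. -/
theorem hplane_eq (z : ℝ) (x : EuclideanSpace ℝ (Fin 2)) :
    (WithLp.toLp 2 ![x 0, x 1, z] : EuclideanSpace ℝ (Fin 3)) =
      ((EuclideanSpace.proj (0 : Fin 2) : EuclideanSpace ℝ (Fin 2) →L[ℝ] ℝ).smulRight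
            (EuclideanSpace.single (0 : Fin 3) (1 : ℝ)) +
          (EuclideanSpace.proj (1 : Fin 2) : EuclideanSpace ℝ (Fin 2) →L[ℝ] ℝ).smulRight
            (EuclideanSpace.single (1 : Fin 3) (1 : ℝ))) x +
        z • EuclideanSpace.single (2 : Fin 3) (1 : ℝ) := by
  ext j
  fin_cases j <;> simp

/-- The linear part maps `eᵢ ∈ ℝ²` to `eᵢ ∈ ℝ³` (`i = 0, 1`). -/
theorem hplaneLin_single :
    ((EuclideanSpace.proj (0 : Fin 2) : EuclideanSpace ℝ (Fin 2) →L[ℝ] ℝ).smulRight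
            (EuclideanSpace.single (0 : Fin 3) (1 : ℝ)) +
          (EuclideanSpace.proj (1 : Fin 2) : EuclideanSpace ℝ (Fin 2) →L[ℝ] ℝ).smulRight
            (EuclideanSpace.single (1 : Fin 3) (1 : ℝ)))
        (EuclideanSpace.single (0 : Fin 2) (1 : ℝ)) = EuclideanSpace.single (0 : Fin 3) (1 : ℝ) ∧
      ((EuclideanSpace.proj (0 : Fin 2) : EuclideanSpace ℝ (Fin 2) →L[ℝ] ℝ).smulRight
            (EuclideanSpace.single (0 : Fin 3) (1 : ℝ)) +
          (EuclideanSpace.proj (1 : Fin 2) : EuclideanSpace ℝ (Fin 2) →L[ℝ] ℝ).smulRight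
            (EuclideanSpace.single (1 : Fin 3) (1 : ℝ)))
        (EuclideanSpace.single (1 : Fin 2) (1 : ℝ)) = EuclideanSpace.single (1 : Fin 3) (1 : ℝ) := by
  constructor
  · ext j; fin_cases j <;> simp
  · ext j; fin_cases j <;> simp

/-- The embedding is continuous. -/
theorem continuous_hplane (z : ℝ) :
    Continuous fun x : EuclideanSpace ℝ (Fin 2) => (WithLp.toLp 2 ![x 0, x 1, z] : EuclideanSpace ℝ (Fin 3)) := by
  have : (fun x : EuclideanSpace ℝ (Fin 2) => (WithLp.toLp 2 ![x 0, x 1, z] : EuclideanSpace ℝ (Fin 3))) =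
      fun x => ((EuclideanSpace.proj (0 : Fin 2) : EuclideanSpace ℝ (Fin 2) →L[ℝ] ℝ).smulRight
            (EuclideanSpace.single (0 : Fin 3) (1 : ℝ)) +
          (EuclideanSpace.proj (1 : Fin 2) : EuclideanSpace ℝ (Fin 2) →L[ℝ] ℝ).smulRight
            (EuclideanSpace.single (1 : Fin 3) (1 : ℝ))) x +
        z • EuclideanSpace.single (2 : Fin 3) (1 : ℝ) := funext (hplane_eq z)
  rw [this]
  fun_prop

/-- The derivative of the embedding is its linear part. -/
theorem hasFDerivAt_hplane (z : ℝ) (x : EuclideanSpace ℝ (Fin 2)) :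
    HasFDerivAt (fun x : EuclideanSpace ℝ (Fin 2) => (WithLp.toLp 2 ![x 0, x 1, z] : EuclideanSpace ℝ (Fin 3)))
      ((EuclideanSpace.proj (0 : Fin 2) : EuclideanSpace ℝ (Fin 2) →L[ℝ] ℝ).smulRight
            (EuclideanSpace.single (0 : Fin 3) (1 : ℝ)) +
          (EuclideanSpace.proj (1 : Fin 2) : EuclideanSpace ℝ (Fin 2) →L[ℝ] ℝ).smulRight
            (EuclideanSpace.single (1 : Fin 3) (1 : ℝ))) x := by
  have : (fun x : EuclideanSpace ℝ (Fin 2) => (WithLp.toLp 2 ![x 0, x 1, z] : EuclideanSpace ℝ (Fin 3))) =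
      fun x => ((EuclideanSpace.proj (0 : Fin 2) : EuclideanSpace ℝ (Fin 2) →L[ℝ] ℝ).smulRight
            (EuclideanSpace.single (0 : Fin 3) (1 : ℝ)) +
          (EuclideanSpace.proj (1 : Fin 2) : EuclideanSpace ℝ (Fin 2) →L[ℝ] ℝ).smulRight
            (EuclideanSpace.single (1 : Fin 3) (1 : ℝ))) x +
        z • EuclideanSpace.single (2 : Fin 3) (1 : ℝ) := funext (hplane_eq z)
  rw [this]
  exact (ContinuousLinearMap.hasFDerivAt _).add_const _

/-- The embedding is smooth. -/
theorem contDiff_hplane (z : ℝ) {n : WithTop ℕ∞} :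
    ContDiff ℝ n fun x : EuclideanSpace ℝ (Fin 2) => (WithLp.toLp 2 ![x 0, x 1, z] : EuclideanSpace ℝ (Fin 3)) := by
  have : (fun x : EuclideanSpace ℝ (Fin 2) => (WithLp.toLp 2 ![x 0, x 1, z] : EuclideanSpace ℝ (Fin 3))) =
      fun x => ((EuclideanSpace.proj (0 : Fin 2) : EuclideanSpace ℝ (Fin 2) →L[ℝ] ℝ).smulRight
            (EuclideanSpace.single (0 : Fin 3) (1 : ℝ)) +
          (EuclideanSpace.proj (1 : Fin 2) : EuclideanSpace ℝ (Fin 2) →L[ℝ] ℝ).smulRight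
            (EuclideanSpace.single (1 : Fin 3) (1 : ℝ))) x +
        z • EuclideanSpace.single (2 : Fin 3) (1 : ℝ) := funext (hplane_eq z)
  rw [this]
  exact (ContinuousLinearMap.contDiff _).add contDiff_const

/-! ### The glue: derivatives of the slice `u = f ∘ ι_z` -/

/-- **First derivatives.**  `∂ᵢ(f ∘ ι_z)(x) = ∂ᵢf(ι_z x)` for `i = 0, 1`, `f` differentiable at `ι_z x`. -/
theorem fderiv_comp_hplane {f : EuclideanSpace ℝ (Fin 3) → ℝ} {z : ℝ} {x : EuclideanSpace ℝ (Fin 2)}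
    (hf : DifferentiableAt ℝ f (WithLp.toLp 2 ![x 0, x 1, z] : EuclideanSpace ℝ (Fin 3))) :
    fderiv ℝ (fun x' : EuclideanSpace ℝ (Fin 2) => f (WithLp.toLp 2 ![x' 0, x' 1, z])) x (EuclideanSpace.single 0 1) =
        fderiv ℝ f (WithLp.toLp 2 ![x 0, x 1, z]) (EuclideanSpace.single 0 1) ∧
      fderiv ℝ (fun x' : EuclideanSpace ℝ (Fin 2) => f (WithLp.toLp 2 ![x' 0, x' 1, z])) x (EuclideanSpace.single 1 1) =
        fderiv ℝ f (WithLp.toLp 2 ![x 0, x 1, z]) (EuclideanSpace.single 1 1) := by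
  have h := hf.hasFDerivAt.comp x (hasFDerivAt_hplane z x)
  rw [show (fun x' : EuclideanSpace ℝ (Fin 2) => f (WithLp.toLp 2 ![x' 0, x' 1, z])) =
      f ∘ (fun x' : EuclideanSpace ℝ (Fin 2) => (WithLp.toLp 2 ![x' 0, x' 1, z] : EuclideanSpace ℝ (Fin 3))) from rfl,
    h.fderiv, ContinuousLinearMap.comp_apply, ContinuousLinearMap.comp_apply, hplaneLin_single.1, hplaneLin_single.2]
  exact ⟨rfl, rfl⟩

/-- Differentiability of the slice. -/
theorem differentiableAt_comp_hplane {f : EuclideanSpace ℝ (Fin 3) → ℝ} {z : ℝ} {x : EuclideanSpace ℝ (Fin 2)}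
    (hf : DifferentiableAt ℝ f (WithLp.toLp 2 ![x 0, x 1, z] : EuclideanSpace ℝ (Fin 3))) :
    DifferentiableAt ℝ (fun x' : EuclideanSpace ℝ (Fin 2) => f (WithLp.toLp 2 ![x' 0, x' 1, z])) x :=
  hf.comp x (hasFDerivAt_hplane z x).differentiableAt

/-- Smoothness of the slice on the preimage of an open set. -/
theorem contDiffOn_comp_hplane {f : EuclideanSpace ℝ (Fin 3) → ℝ} {U : Set (EuclideanSpace ℝ (Fin 3))} {n : WithTop ℕ∞}
    (hf : ContDiffOn ℝ n f U) (z : ℝ) :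
    ContDiffOn ℝ n (fun x' : EuclideanSpace ℝ (Fin 2) => f (WithLp.toLp 2 ![x' 0, x' 1, z]))
      ((fun x' : EuclideanSpace ℝ (Fin 2) => (WithLp.toLp 2 ![x' 0, x' 1, z] : EuclideanSpace ℝ (Fin 3))) ⁻¹' U) :=
  hf.comp (contDiff_hplane z).contDiffOn (fun _ hx => hx)

/-- **Second derivatives.**  If `f` is differentiable near `ι_z x` and `y ↦ ∂ᵢf(y)` is differentiable at `ι_z x`, then
`∂ⱼ∂ᵢ(f ∘ ι_z)(x) = ∂ⱼ∂ᵢf(ι_z x)` (`i, j ∈ {0, 1}`; stated for the four pairs through `i j : Fin 2` and the matching vectors of `ℝ³`). -/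
theorem fderiv2_comp_hplane {f : EuclideanSpace ℝ (Fin 3) → ℝ} {z : ℝ} {x : EuclideanSpace ℝ (Fin 2)}
    (hf : ∀ᶠ y in 𝓝 (WithLp.toLp 2 ![x 0, x 1, z] : EuclideanSpace ℝ (Fin 3)), DifferentiableAt ℝ f y)
    {i : Fin 2} {I : EuclideanSpace ℝ (Fin 3)} (hI : I = EuclideanSpace.single (0 : Fin 3) (1 : ℝ) ∧ i = 0 ∨
      I = EuclideanSpace.single (1 : Fin 3) (1 : ℝ) ∧ i = 1)
    (hfi : DifferentiableAt ℝ (fun y => fderiv ℝ f y I) (WithLp.toLp 2 ![x 0, x 1, z] : EuclideanSpace ℝ (Fin 3))) :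
    fderiv ℝ (fun x' : EuclideanSpace ℝ (Fin 2) => fderiv ℝ (fun x'' : EuclideanSpace ℝ (Fin 2) => f (WithLp.toLp 2 ![x'' 0, x'' 1, z]))
        x' (EuclideanSpace.single i 1)) x (EuclideanSpace.single 0 1) =
        fderiv ℝ (fun y => fderiv ℝ f y I) (WithLp.toLp 2 ![x 0, x 1, z]) (EuclideanSpace.single 0 1) ∧
      fderiv ℝ (fun x' : EuclideanSpace ℝ (Fin 2) => fderiv ℝ (fun x'' : EuclideanSpace ℝ (Fin 2) => f (WithLp.toLp 2 ![x'' 0, x'' 1, z]))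
        x' (EuclideanSpace.single i 1)) x (EuclideanSpace.single 1 1) =
        fderiv ℝ (fun y => fderiv ℝ f y I) (WithLp.toLp 2 ![x 0, x 1, z]) (EuclideanSpace.single 1 1) := by
  -- near `x`, the first derivative of the slice is the slice of the first derivative
  have hnear : ∀ᶠ x' in 𝓝 x, DifferentiableAt ℝ f (WithLp.toLp 2 ![x' 0, x' 1, z] : EuclideanSpace ℝ (Fin 3)) :=
    ((continuous_hplane z).tendsto x).eventually hf
  have hev : (fun x' : EuclideanSpace ℝ (Fin 2) => fderiv ℝ (fun x'' : EuclideanSpace ℝ (Fin 2) => f (WithLp.toLp 2 ![x'' 0, x'' 1, z]))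
        x' (EuclideanSpace.single i 1)) =ᶠ[𝓝 x]
      fun x' => fderiv ℝ f (WithLp.toLp 2 ![x' 0, x' 1, z]) I := by
    filter_upwards [hnear] with x' hx'
    rcases hI with ⟨rfl, rfl⟩ | ⟨rfl, rfl⟩
    · exact (fderiv_comp_hplane hx').1
    · exact (fderiv_comp_hplane hx').2
  rw [hev.fderiv_eq]
  exact fderiv_comp_hplane (f := fun y => fderiv ℝ f y I) hfi

/-! ### The planar dichotomy on a horizontal plane of `ℝ³` -/

/-- **Levi-Civita–Segre on a horizontal plane of `ℝ³`.**  Let `U ⊆ ℝ³` be open, `f ∈ C³(U)`, `a ∈ C²`, `b ∈ C¹`, `z` a height and `x₀ ∈ ℝ²` with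
`ι_z x₀ ∈ U`; suppose that at every point `y ∈ U` of height `z`: `(∂₀f)² + (∂₁f)² = a(f y)` and `∂₀∂₀f + ∂₁∂₁f = b(f y)`, and `a(f(ι_z x₀)) > 0`.  Then there
are a nonempty open `V ⊆ ℝ²` with `ι_z(V) ⊆ U` and EITHER a centre `c ∈ ℝ²` with `∂ᵢf(ι_z x) = (b(f) − a′(f)/2)(ι_z x)·(xᵢ − cᵢ)` for `x ∈ V`, `i = 0,1`
(concentric circles), OR `∇_h f(ι_z x₀) ≠ 0` and `∂₀f(ι_z x)·∂₁f(ι_z x₀) = ∂₁f(ι_z x)·∂₀f(ι_z x₀)` for `x ∈ V` (parallel lines). -/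
theorem circles_or_lines_of_isoparametric_slice {f : EuclideanSpace ℝ (Fin 3) → ℝ} {U : Set (EuclideanSpace ℝ (Fin 3))} (hU : IsOpen U)
    (hf : ContDiffOn ℝ 3 f U) {a b : ℝ → ℝ} (ha : ContDiff ℝ 2 a) (hb : ContDiff ℝ 1 b) {z : ℝ} {x₀ : EuclideanSpace ℝ (Fin 2)}
    (hx₀ : (WithLp.toLp 2 ![x₀ 0, x₀ 1, z] : EuclideanSpace ℝ (Fin 3)) ∈ U)
    (h₁ : ∀ y ∈ U, y 2 = z →
      (fderiv ℝ f y (EuclideanSpace.single 0 1)) ^ 2 + (fderiv ℝ f y (EuclideanSpace.single 1 1)) ^ 2 = a (f y))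
    (h₂ : ∀ y ∈ U, y 2 = z →
      fderiv ℝ (fun y' => fderiv ℝ f y' (EuclideanSpace.single 0 1)) y (EuclideanSpace.single 0 1) +
        fderiv ℝ (fun y' => fderiv ℝ f y' (EuclideanSpace.single 1 1)) y (EuclideanSpace.single 1 1) = b (f y))
    (hpos : 0 < a (f (WithLp.toLp 2 ![x₀ 0, x₀ 1, z]))) :
    ∃ V : Set (EuclideanSpace ℝ (Fin 2)), IsOpen V ∧ V.Nonempty ∧
      (∀ x ∈ V, (WithLp.toLp 2 ![x 0, x 1, z] : EuclideanSpace ℝ (Fin 3)) ∈ U) ∧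
      ((∃ c : EuclideanSpace ℝ (Fin 2), ∀ x ∈ V,
          fderiv ℝ f (WithLp.toLp 2 ![x 0, x 1, z]) (EuclideanSpace.single 0 1) =
              (b (f (WithLp.toLp 2 ![x 0, x 1, z])) - deriv a (f (WithLp.toLp 2 ![x 0, x 1, z])) / 2) * (x 0 - c 0) ∧
            fderiv ℝ f (WithLp.toLp 2 ![x 0, x 1, z]) (EuclideanSpace.single 1 1) =
              (b (f (WithLp.toLp 2 ![x 0, x 1, z])) - deriv a (f (WithLp.toLp 2 ![x 0, x 1, z])) / 2) * (x 1 - c 1)) ∨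
       ((fderiv ℝ f (WithLp.toLp 2 ![x₀ 0, x₀ 1, z]) (EuclideanSpace.single 0 1) ≠ 0 ∨
            fderiv ℝ f (WithLp.toLp 2 ![x₀ 0, x₀ 1, z]) (EuclideanSpace.single 1 1) ≠ 0) ∧
          ∀ x ∈ V, fderiv ℝ f (WithLp.toLp 2 ![x 0, x 1, z]) (EuclideanSpace.single 0 1) *
                fderiv ℝ f (WithLp.toLp 2 ![x₀ 0, x₀ 1, z]) (EuclideanSpace.single 1 1) =
              fderiv ℝ f (WithLp.toLp 2 ![x 0, x 1, z]) (EuclideanSpace.single 1 1) *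
                fderiv ℝ f (WithLp.toLp 2 ![x₀ 0, x₀ 1, z]) (EuclideanSpace.single 0 1))) := by
  -- the slice and its domain
  set ι : EuclideanSpace ℝ (Fin 2) → EuclideanSpace ℝ (Fin 3) := fun x => WithLp.toLp 2 ![x 0, x 1, z] with hι
  set u : EuclideanSpace ℝ (Fin 2) → ℝ := fun x => f (ι x) with hu
  set U₂ : Set (EuclideanSpace ℝ (Fin 2)) := ι ⁻¹' U with hU₂
  have hιc : Continuous ι := continuous_hplane z
  have hU₂o : IsOpen U₂ := hU.preimage hιc
  have hx₀U : x₀ ∈ U₂ := hx₀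
  have huC : ContDiffOn ℝ 3 u U₂ := contDiffOn_comp_hplane hf z
  -- regularity of `f` at the points `ι x`, `x ∈ U₂`
  have hfC : ∀ x ∈ U₂, ContDiffAt ℝ 3 f (ι x) := fun x hx => hf.contDiffAt (hU.mem_nhds hx)
  have hfd : ∀ x ∈ U₂, DifferentiableAt ℝ f (ι x) := fun x hx => (hfC x hx).differentiableAt (by norm_num)
  have hfdn : ∀ x ∈ U₂, ∀ᶠ y in 𝓝 (ι x), DifferentiableAt ℝ f y := fun x hx =>
    ((hfC x hx).eventually (by simp)).mono fun y hy => hy.differentiableAt (by norm_num)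
  have hfId : ∀ x ∈ U₂, ∀ I : EuclideanSpace ℝ (Fin 3), DifferentiableAt ℝ (fun y => fderiv ℝ f y I) (ι x) :=
    fun x hx I => (((hfC x hx).fderiv_right (m := 2) (by norm_num)).clm_apply contDiffAt_const).differentiableAt
      (by norm_num)
  -- the isoparametric hypotheses for `u`
  have h₁' : ∀ x ∈ U₂, (fderiv ℝ u x (EuclideanSpace.single 0 1)) ^ 2 + (fderiv ℝ u x (EuclideanSpace.single 1 1)) ^ 2 =
      a (u x) := by
    intro x hx
    rw [(fderiv_comp_hplane (hfd x hx)).1, (fderiv_comp_hplane (hfd x hx)).2]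
    exact h₁ (ι x) hx rfl
  have h₂' : ∀ x ∈ U₂, fderiv ℝ (fun x' => fderiv ℝ u x' (EuclideanSpace.single 0 1)) x (EuclideanSpace.single 0 1) +
      fderiv ℝ (fun x' => fderiv ℝ u x' (EuclideanSpace.single 1 1)) x (EuclideanSpace.single 1 1) = b (u x) := by
    intro x hx
    rw [(fderiv2_comp_hplane (hfdn x hx) (i := 0) (Or.inl ⟨rfl, rfl⟩) (hfId x hx _)).1,
      (fderiv2_comp_hplane (hfdn x hx) (i := 1) (Or.inr ⟨rfl, rfl⟩) (hfId x hx _)).2]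
    exact h₂ (ι x) hx rfl
  -- the planar theorem
  obtain ⟨V, hVo, hVne, hVU, hcase⟩ := circles_or_lines_of_isoparametric hU₂o hx₀U huC ha hb h₁' h₂' hpos
  refine ⟨V, hVo, hVne, fun x hx => hVU hx, ?_⟩
  rcases hcase with ⟨c, hc⟩ | ⟨hne, hpar⟩
  · left
    refine ⟨c, fun x hx => ?_⟩
    have h0 := hc x hx 0
    have h1 := hc x hx 1
    rw [(fderiv_comp_hplane (hfd x (hVU hx))).1] at h0
    rw [(fderiv_comp_hplane (hfd x (hVU hx))).2] at h1
    exact ⟨h0, h1⟩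
  · right
    rw [(fderiv_comp_hplane (hfd x₀ hx₀U)).1, (fderiv_comp_hplane (hfd x₀ hx₀U)).2] at hne
    refine ⟨hne, fun x hx => ?_⟩
    have h := hpar x hx
    rw [(fderiv_comp_hplane (hfd x (hVU hx))).1, (fderiv_comp_hplane (hfd x (hVU hx))).2,
      (fderiv_comp_hplane (hfd x₀ hx₀U)).1, (fderiv_comp_hplane (hfd x₀ hx₀U)).2] at h
    exact h

end Summit.NavierStokesRegularity.NavierStokesRegularity.Theorems.PoloidalWindowDoorPoloidalWindowRigidityUntwistedSliceGlue

end
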